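import Summits.QuantumFields.YangMills.Theorems.BalabanUVNodesN21ProfiledThresholdSync

/-!
# YM-DAG node N21 (= NE7c), PROFILED ROAD, THRESHOLD SYNCHRONISATION — SANITY ∕ VACUITY GUARD for `BalabanUVNodesN21ProfiledThresholdSync`:
# the two-threshold realized reading of its §3 is INHABITED with GENUINELY DIFFERENT thresholds at a non-degenerate bundle, and `S_N21` FIRES on it

Track A of `YM-PLAN.md` (cell `pub-ymgap`, HUMAN RULING D-0062 ∕ D-0088), node **N21**; seat `pub-ymgap-dag-n21-e` (R141 (C), strategy s3 = ALTERNATIVE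
CURRENCY), generation 1, file 3′ (companion of file 3 `BalabanUVNodesN21ProfiledThresholdSync`, as n21-a's 3′∕6′∕8′ were of its files 3∕6∕8).  Kernel bookkeeping:
0 `def`, 0 `sorry`, standard axioms.  COUNT-NEUTRAL; `--supports` the K3 item `SpineGivenEndpointR11` (stmt-QuantumFields-19676).

HONEST FRAMING.  A vacuity guard, not an estimate: pv07's §5 toy (`T4LipschitzLedger.Sanity`: one term per cutoff, a point space with the Dirac mass, ONE
small-field factor of age `0` with the piecewise-linear profile of width `1∕2`, run A's threshold `θ ≡ 1`, run A testing `3∕4`) with run B testing at ITS OWN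
threshold `θ^B_K = 1 + (1∕2)^K∕8 ≠ 1` the value `u^B_K = θ^B_K·(3∕4 + (1∕2)^K∕8)` (so run B's factor and weights are pv07's `1∕2 − (1∕2)^K∕4`), width
`ρ_j = (1∕2)^j∕4`, threshold gap `r_j = (1∕2)^j∕8`, sibling constants `S ≡ 4`.  Every binder of file 3's §2∕§3 holds on it (`termRepr_A'`, `termRepr_B'`,
`supClose'`, `thresholdGap'`, `siblingSuppression_A'∕_B'`), the clamp re-reading reproduces both factors so run A's realized shell part ON THE CLAMPED PAIR is
`(1∕2)^K∕4 > 0` (`shellW_A'`), the band weight is `3·(1∕2)^K` (`bandWeight'`), and `s_N21_fires_on_twoThresholdReprReading` exhibits a reading predicate of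
file 3 §3's exact shape, INHABITED at that bundle, with `S_N21` delivered by `s_N21_of_twoThresholdReprReading`.  A toy, NOT Bałaban's terms; NE7c NOT PRINTED,
NOT proved; nothing continuum ∕ ℝ⁴ ∕ OS ∕ mass gap ∕ Clay.  §0 puts file 3's located A5 note in kernel form — WHICH sibling is displayed after
synchronisation: for a small-field slot the clamped shell IS the slot's own sharp characteristic function `1[u < θ]` (`shell_small_clamp_eq_smallInd`), for a
large-field slot it is the whole slot (`shell_large_clamp_eq_one`: the factor-removed term, suppressed structurally by the polarity flip); and it records the
SHARPER alternative WITHOUT clamping, `profile_sub_min_le_shell_twoThresholds` — the two-threshold extension of pv07's `LipProfile.profile_sub_min_le_shell`,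
in which rule R-η-1's shell-restricted sibling survives the threshold gap at width `κθ^A + Δ + |θ^A − θ^B|` (the clamp of file 3 trades this sharper sibling
for the one-threshold convention of `TermRepr` ∕ `SupClose`).
-/

set_option autoImplicit false

noncomputable section

open scoped BigOperators
open MeasureTheory

namespace Summit.QuantumFields.YangMills.Theorems.N21ProfiledThresholdSync

open Literature.MathematicalPhysics.QuantumFieldTheory.Balaban1983to89
open T4IndicatorShell (ShellWeightBound)
open T4LipschitzCutoff (LipProfile SiblingSuppression lipWeight)
open T4LipschitzLedger (Pol facAt TermRepr SupClose sibW shellW)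
open YMDAG.UVSplit (SpineCarriers SpineRecordPred S_N21)
open Finset

/-! ## §0 WHICH SIBLING IS DISPLAYED after synchronisation (located A5 note of file 3, in kernel form) -/

section WhichSibling

open T4IndicatorShell (shellBelow smallInd)

/-- **SMALL-FIELD SLOT: the clamped shell IS Bałaban's sharp small-field characteristic function of the ORIGINAL variable.**  For `κ > 0`, `θ > 0`
and any width `Δ ≥ 0`, the same-run shell of pv07's small polarity (`Pol.small.shell u θ κ Δ = 1[(1−κ)θ − Δ ≤ u < θ]`) READ ON THE CLAMPED VARIABLE
`w = max((1−κ)θ, min θ u)` equals `1[u < θ]`: the lower edge is always met (`w ≥ (1−κ)θ`), and `w < θ ↔ u < θ`.  So after synchronisation the sibling a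
small-field min-piece is charged against is the term with the slot's profile replaced by ITS OWN SHARP small-field characteristic function — NE7b species as
before (node N20's lane), coarser than the shell-restricted sibling of the equal-threshold case. [folklore] -/
theorem shell_small_clamp_eq_smallInd {κ θ Δ : ℝ} (hκ : 0 < κ) (hθ : 0 < θ) (hΔ : 0 ≤ Δ) (u : ℝ) :
    Pol.small.shell (max ((1 - κ) * θ) (min θ u)) θ κ Δ = smallInd u θ := by
  simp only [Pol.shell_small, shellBelow, smallInd]
  have hl : θ - (κ * θ + Δ) ≤ max ((1 - κ) * θ) (min θ u) := (le_max_left _ _).trans' (by nlinarith)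
  by_cases hu : u < θ
  · have hw : max ((1 - κ) * θ) (min θ u) < θ := max_lt (by nlinarith) ((min_le_right _ _).trans_lt hu)
    rw [if_pos ⟨hl, hw⟩, if_pos hu]
  · have hw : ¬ max ((1 - κ) * θ) (min θ u) < θ := by
      rw [min_eq_left (not_lt.1 hu)]
      exact not_lt.2 (le_max_right _ _)
    rw [if_neg (fun h => hw h.2), if_neg hu]

/-- **LARGE-FIELD SLOT: the clamped shell is the WHOLE slot** (`≡ 1`) for a positive width: pv07's large-polarity shell
`1[(1−κ)θ ≤ u < θ + Δ]` read on `w ∈ [(1−κ)θ, θ]` is identically `1` when `Δ > 0` — the sibling a large-field min-piece is charged against after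
synchronisation is the term with that factor REMOVED; its suppression is the STRUCTURAL one (both polarities of the slot present in the class: the
polarity-flip involution, `T4PatternLayer.siblingSuppression_layer₂`, constant `2`), not a large-field small factor. [folklore] -/
theorem shell_large_clamp_eq_one {κ θ Δ : ℝ} (hκ0 : 0 ≤ κ) (hθ : 0 < θ) (hΔ : 0 < Δ) (u : ℝ) :
    Pol.large.shell (max ((1 - κ) * θ) (min θ u)) θ κ Δ = 1 := by
  simp only [Pol.shell_large, shellBelow]
  have h1 : θ + Δ - (κ * θ + Δ) ≤ max ((1 - κ) * θ) (min θ u) := (le_max_left _ _).trans' (by nlinarith)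
  have h2 : max ((1 - κ) * θ) (min θ u) < θ + Δ :=
    (max_le (by nlinarith) (min_le_left _ _)).trans_lt (by linarith)
  rw [if_pos ⟨h1, h2⟩]


variable {χ : ℝ → ℝ} {κ L : ℝ}

/-- **THE SHARPER, SHELL-RESTRICTED ALTERNATIVE (same species as the equal-threshold case).**  Without clamping, the two-threshold mismatch of a small-field
slot is still the Lipschitz constant times an EFFECTIVE width times the slot's OWN shell-restricted indicator: for a `LipProfile`, `θ^A, θ^B > 0`,
`|u^A − u^B| ≤ Δ`:
`χ(u^A∕θ^A) − min(χ(u^A∕θ^A), χ(u^B∕θ^B)) ≤ L·(Δ∕θ^A + (θ^A + Δ)·|θ^A − θ^B|∕(θ^A θ^B)) · 1[(1−κ)θ^A − Δ − |θ^A − θ^B| ≤ u^A < θ^A]`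
— the two-threshold extension of pv07's `T4LipschitzCutoff.LipProfile.profile_sub_min_le_shell` (a positive mismatch forces `u^A < θ^A` and
`u^B > (1−κ)θ^B`, whence the support and `u^B < θ^A + Δ` in the Lipschitz estimate of `|u^A∕θ^A − u^B∕θ^B|`).  So rule R-η-1's shell-restricted sibling
survives the threshold gap, at width `κθ^A + Δ + |θ^A − θ^B|`; the clamp of file 3 trades this sharper sibling for the one-threshold CONVENTION.
[folklore] -/
theorem profile_sub_min_le_shell_twoThresholds (hχ : LipProfile χ κ L) {θA θB uA uB Δ : ℝ} (hθA : 0 < θA) (hθB : 0 < θB)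
    (hΔ : |uA - uB| ≤ Δ) :
    χ (uA / θA) - min (χ (uA / θA)) (χ (uB / θB)) ≤
      L * (Δ / θA + (θA + Δ) * |θA - θB| / (θA * θB)) * shellBelow uA θA (κ * θA + Δ + |θA - θB|) := by
  have hΔ0 : 0 ≤ Δ := (abs_nonneg _).trans hΔ
  obtain ⟨hΔ1, hΔ2⟩ := abs_le.1 hΔ
  have hL := hχ.L_pos
  have hc : 0 ≤ Δ / θA + (θA + Δ) * |θA - θB| / (θA * θB) := by positivity
  rcases le_or_gt (χ (uA / θA)) (χ (uB / θB)) with hle | hlt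
  · rw [min_eq_left hle, sub_self]
    exact mul_nonneg (mul_nonneg hL.le hc) (T4IndicatorShell.shellBelow_nonneg _ _ _)
  · rw [min_eq_right hlt.le]
    -- a positive mismatch forces run A's factor `> 0` (so `uA < θA`) and run B's factor `< 1` (so `uB > (1−κ)θB > 0`)
    have hpA : χ (uA / θA) ≠ 0 := fun h0 => by
      rw [h0] at hlt; exact (not_lt.2 (hχ.nonneg _)) hlt
    have huA : uA < θA := by
      have := hχ.lt_one_of_ne_zero hpA; rwa [div_lt_one hθA] at this
    have hpB : χ (uB / θB) ≠ 1 := fun h1 => by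
      rw [h1] at hlt; exact (not_lt.2 (hχ.le_one _)) hlt
    have hk0 := hχ.kappa_pos
    have hk1 := hχ.kappa_lt_one
    have huB : (1 - κ) * θB < uB := by
      by_contra hcon
      exact hpB (hχ.eq_one _ (by rw [div_le_iff₀ hθB]; exact not_lt.1 hcon))
    have huB0 : 0 < uB := lt_of_le_of_lt (by nlinarith) huB
    -- the shell indicator equals `1` on the support
    have hshell : shellBelow uA θA (κ * θA + Δ + |θA - θB|) = 1 := by
      unfold shellBelow
      refine if_pos ⟨?_, huA⟩
      have h1 : (1 - κ) * (θA - |θA - θB|) ≤ (1 - κ) * θB := by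
        have : θA - |θA - θB| ≤ θB := by linarith [le_abs_self (θA - θB)]
        nlinarith
      have h2 : (1 - κ) * |θA - θB| ≤ |θA - θB| := by nlinarith [abs_nonneg (θA - θB)]
      nlinarith
    rw [hshell, mul_one]
    -- the Lipschitz estimate with the rescaling cost
    have hdiff : |uA / θA - uB / θB| ≤ Δ / θA + (θA + Δ) * |θA - θB| / (θA * θB) := by
      have e : uA / θA - uB / θB = (uA - uB) / θA + uB * (θB - θA) / (θA * θB) := by field_simp; ring
      rw [e]
      refine (abs_add_le _ _).trans (add_le_add ?_ ?_)
      · rw [abs_div, abs_of_pos hθA]; exact div_le_div_of_nonneg_right hΔ hθA.le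
      · rw [abs_div, abs_mul, abs_of_pos huB0, abs_of_pos (mul_pos hθA hθB), abs_sub_comm]
        have huB' : uB ≤ θA + Δ := by linarith
        exact div_le_div_of_nonneg_right (mul_le_mul_of_nonneg_right huB' (abs_nonneg _)) (mul_pos hθA hθB).le
    calc χ (uA / θA) - χ (uB / θB) ≤ |χ (uA / θA) - χ (uB / θB)| := le_abs_self _
      _ ≤ L * |uA / θA - uB / θB| := hχ.lip _ _
      _ ≤ L * (Δ / θA + (θA + Δ) * |θA - θB| / (θA * θB)) := mul_le_mul_of_nonneg_left hdiff hL.le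

end WhichSibling

/-! ## The two-threshold realized reading is INHABITED with GENUINELY DIFFERENT thresholds, and `S_N21` fires -/

section NonVacuity

open T4LipschitzLedger.Sanity

/-! pv07's §5 toy (`T4LipschitzLedger.Sanity`: one term per cutoff, a point space with the Dirac mass, ONE small-field factor of age `0` with the
piecewise-linear profile of width `1∕2`, run A's threshold `θ ≡ 1`, run A testing `3∕4`) with run B now testing at its OWN threshold
`θ^B_K = 1 + (1∕2)^K∕8 ≠ 1` the value `u^B_K = θ^B_K·(3∕4 + (1∕2)^K∕8)` (so that run B's factor and weights are pv07's: `χ(u^B∕θ^B) = 1∕2 − (1∕2)^K∕4`,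
`B = 1∕2 − (1∕2)^K∕4`), width `ρ_j = (1∕2)^j∕4`, threshold gap `r_j = (1∕2)^j∕8`, sibling constants `S ≡ 4`.  A toy, NOT Bałaban's terms. -/

/-- the raised threshold `1 + (1∕2)^K∕8` is positive. [folklore] -/
theorem thrB_pos (K : ℕ) : 0 < 1 + (1 / 2 : ℝ) ^ K / 8 := by have := half_pow_pos K; positivity

/-- Run B's slot factor at ITS OWN threshold is pv07's `1∕2 − (1∕2)^K∕4`. [folklore] -/
theorem facAt_B' (K : ℕ) :
    facAt χ (slot K ()) (pol K ()) (fun _ => 1 + (1 / 2 : ℝ) ^ K / 8)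
        (fun _ => (1 + (1 / 2 : ℝ) ^ K / 8) * (3 / 4 + (1 / 2 : ℝ) ^ K / 8)) 0 = 1 / 2 - (1 / 2 : ℝ) ^ K / 4 := by
  simp only [facAt, pol, χ, Pol.fac_small]
  rw [mul_div_cancel_left₀ _ (thrB_pos K).ne']
  have h := profile_B K
  rw [div_one] at h
  exact h

/-- **run A is represented** (pv07's `termRepr_A`, with run B's NEW variable in the other slot — only measurability is re-checked). [folklore] -/
theorem termRepr_A' :
    TermRepr 1 T A χ κ Lχ 0 n μ m slot pol θ uA (fun K _ _ _ => (1 + (1 / 2 : ℝ) ^ K / 8) * (3 / 4 + (1 / 2 : ℝ) ^ K / 8)) R where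
  profile := termRepr_A.profile
  thr_pos := termRepr_A.thr_pos
  slot_mem := termRepr_A.slot_mem
  slot_band := termRepr_A.slot_band
  meas _ _ _ _ _ := ⟨measurable_const, measurable_const⟩
  rem_nonneg := termRepr_A.rem_nonneg
  rem_int := termRepr_A.rem_int
  repr := termRepr_A.repr

/-- **run B is represented AT ITS OWN thresholds** `1 + (1∕2)^K∕8` (weights `B = 1∕2 − (1∕2)^K∕4` as in pv07). [folklore] -/
theorem termRepr_B' :
    TermRepr 1 T B χ κ Lχ 0 n μ m slot pol (fun K _ _ => 1 + (1 / 2 : ℝ) ^ K / 8)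
      (fun K _ _ _ => (1 + (1 / 2 : ℝ) ^ K / 8) * (3 / 4 + (1 / 2 : ℝ) ^ K / 8)) uA R where
  profile := profiles
  thr_pos K _ _ _ _ := thrB_pos K
  slot_mem := termRepr_B.slot_mem
  slot_band := termRepr_B.slot_band
  meas _ _ _ _ _ := ⟨measurable_const, measurable_const⟩
  rem_nonneg := termRepr_B.rem_nonneg
  rem_int := termRepr_B.rem_int
  repr K t _ τ _ := by
    obtain ⟨⟩ := τ
    simp only [μ, integral_dirac, m, prod_range_one, R, mul_one]
    rw [facAt_B' K]; rfl

/-- **(F∞) at run A's threshold** with width `(1∕2)^j∕4`: `|3∕4 − (1 + x∕8)(3∕4 + x∕8)| = 7x∕32 + x²∕64 ≤ x∕4` for `x = (1∕2)^K ≤ 1`. [folklore] -/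
theorem supClose' :
    SupClose T μ m slot θ uA (fun K _ _ _ => (1 + (1 / 2 : ℝ) ^ K / 8) * (3 / 4 + (1 / 2 : ℝ) ^ K / 8))
      fun j => (1 / 2 : ℝ) ^ j / 4 := fun K τ _ i _ => ae_of_all _ fun v => by
  have hx0 := half_pow_pos K
  have hx1 := half_pow_le_one K
  simp only [uA, slot, θ, Nat.sub_zero, mul_one]
  rw [abs_sub_comm, abs_of_nonneg (by nlinarith)]
  nlinarith

/-- **the threshold gap** `|1 − (1 + x∕8)| = x∕8 = r_K·θ^A` (the slot has age `0`, so its level is `K`). [folklore] -/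
theorem thresholdGap' (K : ℕ) (τ : Unit) (i : ℕ) :
    |θ K τ i - (1 + (1 / 2 : ℝ) ^ K / 8)| ≤ (1 / 2 : ℝ) ^ (K - (slot K τ i).1) / 8 * θ K τ i := by
  have hx0 := half_pow_pos K
  simp only [θ, slot, Nat.sub_zero, mul_one]
  rw [show (1 : ℝ) - (1 + (1 / 2 : ℝ) ^ K / 8) = -((1 / 2 : ℝ) ^ K / 8) by ring, abs_neg, abs_of_nonneg (by positivity)]

/-- the realized sibling weight of either run, for ANY variable family and ANY width, is at most `1` (one factor, remainder `1`, a point mass;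
pv07's `sibW_le_one` at a general width). [folklore] -/
theorem sibW_le_one' {uX : (K : ℕ) → (τ : Unit) → ℕ → Ω K τ → ℝ} (w : ℕ → ℝ) (σ : Σ _ : ℕ, ℕ) (K : ℕ) (t : ℝ) :
    sibW χ κ μ m slot pol θ uX R w σ K t () ≤ 1 := by
  unfold sibW
  calc ∑ i ∈ range (m K ()) with slot K () i = σ,
        ∫ v, T4LipschitzLedger.sibAt χ κ (slot K ()) (pol K ()) (θ K ()) (fun j => uX K () j v) (w (K - (slot K () i).1))
          (m K ()) i * R K t () v ∂(μ K ())
      ≤ ∑ i ∈ range (m K ()),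
        ∫ v, T4LipschitzLedger.sibAt χ κ (slot K ()) (pol K ()) (θ K ()) (fun j => uX K () j v) (w (K - (slot K () i).1))
          (m K ()) i * R K t () v ∂(μ K ()) := by
        refine sum_le_sum_of_subset_of_nonneg (filter_subset _ _) fun i hi _ => ?_
        simp only [μ, integral_dirac, R, mul_one]
        exact T4LipschitzLedger.sibAt_nonneg profiles (mem_range.1 hi)
    _ ≤ 1 := by
        simp only [μ, integral_dirac, R, mul_one, m, sum_range_one]
        exact T4LipschitzLedger.sibAt_le_one profiles (by norm_num)

/-- **sibling suppression in run A** with `S ≡ 4`, for any variable family and width (in particular the CLAMPED one). [folklore] -/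
theorem siblingSuppression_A' (w : ℕ → ℝ) (uX : (K : ℕ) → (τ : Unit) → ℕ → Ω K τ → ℝ) :
    SiblingSuppression 1 T A 0 n (sibW χ κ μ m slot pol θ uX R w) S := by
  intro σ _ K t _
  simp only [T, sum_singleton, S, A]
  linarith [sibW_le_one' (uX := uX) w σ K t]

/-- **sibling suppression in run B** with `S ≡ 4`, for any variable family and width. [folklore] -/
theorem siblingSuppression_B' (w : ℕ → ℝ) (uX : (K : ℕ) → (τ : Unit) → ℕ → Ω K τ → ℝ) :
    SiblingSuppression 1 T B 0 n (sibW χ κ μ m slot pol θ uX R w) S := by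
  intro σ _ K t _
  simp only [T, sum_singleton, S, B]
  linarith [sibW_le_one' (uX := uX) w σ K t, half_pow_le_one K]

/-- **NON-DEGENERACY: run A's realized shell part ON THE CLAMPED PAIR is `(1∕2)^K∕4 > 0` at every cutoff** (the clamp re-reading reproduces both
factors: `1∕2` and `1∕2 − (1∕2)^K∕4`). [folklore] -/
theorem shellW_A' (K : ℕ) (t : ℝ) :
    shellW χ μ m slot pol θ
        (fun K τ i v => max ((1 - κ (slot K τ i).1) * θ K τ i) (min (θ K τ i) (uA K τ i v)))
        (fun K τ i _ => max ((1 - κ (slot K τ i).1) * θ K τ i) (min (θ K τ i)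
            (θ K τ i / (1 + (1 / 2 : ℝ) ^ K / 8) * ((1 + (1 / 2 : ℝ) ^ K / 8) * (3 / 4 + (1 / 2 : ℝ) ^ K / 8)))))
        R K t () = (1 / 2 : ℝ) ^ K / 4 := by
  have hx0 := half_pow_pos K
  have hx1 := half_pow_le_one K
  have hA : facAt χ (slot K ()) (pol K ()) (θ K ())
      (fun j => max ((1 - κ (slot K () j).1) * θ K () j) (min (θ K () j) (uA K () j ()))) 0 = 1 / 2 :=
    (facAt_clamp_eq (u := fun j => uA K () j ()) profiles (by norm_num [θ])).trans (facAt_A K ())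
  have hB : facAt χ (slot K ()) (pol K ()) (θ K ())
      (fun j => max ((1 - κ (slot K () j).1) * θ K () j) (min (θ K () j)
        (θ K () j / (1 + (1 / 2 : ℝ) ^ K / 8) * ((1 + (1 / 2 : ℝ) ^ K / 8) * (3 / 4 + (1 / 2 : ℝ) ^ K / 8))))) 0 =
      1 / 2 - (1 / 2 : ℝ) ^ K / 4 :=
    (facAt_clamp_rescaled_eq (θB := fun _ => 1 + (1 / 2 : ℝ) ^ K / 8)
      (u := fun _ => (1 + (1 / 2 : ℝ) ^ K / 8) * (3 / 4 + (1 / 2 : ℝ) ^ K / 8)) profiles (by norm_num [θ]) (thrB_pos K)).trans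
      (facAt_B' K)
  simp only [shellW, μ, integral_dirac, R, mul_one, m, sum_range_one, T4LipschitzLedger.pieceAt, T4LipschitzCutoff.minPiece, range_zero,
    prod_empty, one_mul, Finset.Ico_self, mul_one, hA, hB]
  rw [min_eq_right (by linarith)]
  ring

/-- The toy's band weight at width `ρ + r = (3∕8)(1∕2)^j` is `2·4·(3∕8)(1∕2)^K = 3·(1∕2)^K`. [folklore] -/
theorem bandWeight' (K : ℕ) :
    ∑ a ∈ range (0 + 1), (n a : ℝ) * lipWeight Lχ S (fun j => (1 / 2 : ℝ) ^ j / 4 + (1 / 2 : ℝ) ^ j / 8) a K = 3 * (1 / 2 : ℝ) ^ K := by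
  simp only [zero_add, sum_range_one, n, Nat.cast_one, one_mul, lipWeight, Nat.zero_le, if_true, Lχ, S, Nat.sub_zero]
  ring

/-- **THE TWO-THRESHOLD REALIZED READING IS INHABITED, WITH DIFFERENT THRESHOLDS, AND `S_N21` FIRES ON IT.**  There is a carrier predicate `SRec` over
`SU(2)` data such that (i) `SRec` is a two-threshold realized reading predicate — every bundle it pins carries EXACTLY the package of §3's
`s_N21_of_twoThresholdReprReading`; (ii) it is INHABITED by the toy above — whose run-B thresholds `1 + (1∕2)^K∕8` DIFFER from run A's `1` at every
cutoff, clause (iii) — at a bundle with nonempty classes, positive weights `1∕2`, `1∕2 − (1∕2)^K∕4`, run A's clamped realized shell part `(1∕2)^K∕4 > 0`,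
nonnegative run-B shell part and positive record weight `3·(1∕2)^K`; (iv) `S_N21 SRec` holds (by §3).  Audit A1–A6: the binder list of §2∕§3 is jointly
satisfiable by non-trivial data with a genuine threshold gap.  A toy, NOT Bałaban's terms. [folklore] -/
theorem s_N21_fires_on_twoThresholdReprReading :
    ∃ SRec : SpineRecordPred 2,
      (∀ (F : T4Continuum.T4Family) (D : YMDAG.UVSplit.Datum F 2) (g₀ : ℕ → ℝ) (os : List (T4Continuum.ULoop F))
          (S : SpineCarriers), SRec F D g₀ os S →
        ∃ (Ω : ℕ → S.ι → Type) (_mΩ : ∀ K τ, MeasurableSpace (Ω K τ)) (μ : (K : ℕ) → (τ : S.ι) → Measure (Ω K τ))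
          (χ : ℕ → ℝ → ℝ) (κ Lχ : ℕ → ℝ) (Nw : ℕ) (n : ℕ → ℕ) (m : ℕ → S.ι → ℕ) (slot : ℕ → S.ι → ℕ → Σ _ : ℕ, ℕ)
          (pol : ℕ → S.ι → ℕ → Pol) (θA θB : ℕ → S.ι → ℕ → ℝ) (uA uB : (K : ℕ) → (τ : S.ι) → ℕ → Ω K τ → ℝ)
          (RA RB : (K : ℕ) → ℝ → (τ : S.ι) → Ω K τ → ℝ) (ρ r Ssup : ℕ → ℝ),
          TermRepr S.l₀ S.T S.A χ κ Lχ Nw n μ m slot pol θA uA uB RA ∧ TermRepr S.l₀ S.T S.B χ κ Lχ Nw n μ m slot pol θB uB uA RB ∧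
          SupClose S.T μ m slot θA uA uB ρ ∧
          (∀ K, ∀ τ ∈ S.T K, ∀ i < m K τ, |θA K τ i - θB K τ i| ≤ r (K - (slot K τ i).1) * θA K τ i) ∧
          SiblingSuppression S.l₀ S.T S.A Nw n
            (sibW χ κ μ m slot pol θA (fun K τ i v => max ((1 - κ (slot K τ i).1) * θA K τ i) (min (θA K τ i) (uA K τ i v))) RA
              fun j => ρ j + r j) Ssup ∧
          SiblingSuppression S.l₀ S.T S.B Nw n
            (sibW χ κ μ m slot pol θA
              (fun K τ i v => max ((1 - κ (slot K τ i).1) * θA K τ i) (min (θA K τ i) (θA K τ i / θB K τ i * uB K τ i v))) RB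
              fun j => ρ j + r j) Ssup ∧
          (∀ a ≤ Nw, 0 ≤ Ssup a) ∧ (∀ j, 0 ≤ ρ j) ∧ (∀ j, 0 ≤ r j) ∧ Summable ρ ∧ Summable r ∧
          S.shA = shellW χ μ m slot pol θA
            (fun K τ i v => max ((1 - κ (slot K τ i).1) * θA K τ i) (min (θA K τ i) (uA K τ i v)))
            (fun K τ i v => max ((1 - κ (slot K τ i).1) * θA K τ i) (min (θA K τ i) (θA K τ i / θB K τ i * uB K τ i v))) RA ∧
          S.shB = shellW χ μ m slot pol θA
            (fun K τ i v => max ((1 - κ (slot K τ i).1) * θA K τ i) (min (θA K τ i) (θA K τ i / θB K τ i * uB K τ i v)))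
            (fun K τ i v => max ((1 - κ (slot K τ i).1) * θA K τ i) (min (θA K τ i) (uA K τ i v))) RB ∧
          (∀ K, ∑ a ∈ range (Nw + 1), (n a : ℝ) * lipWeight Lχ Ssup (fun j => ρ j + r j) a K ≤ S.Wsh K) ∧ Summable S.Wsh) ∧
      (∃ (F : T4Continuum.T4Family) (D : YMDAG.UVSplit.Datum F 2) (g₀ : ℕ → ℝ) (os : List (T4Continuum.ULoop F))
          (S : SpineCarriers), SRec F D g₀ os S ∧ (∀ K, (S.T K).Nonempty) ∧
          (∀ K t τ, 0 < S.A K t τ ∧ 0 < S.B K t τ ∧ 0 < S.shA K t τ ∧ 0 ≤ S.shB K t τ) ∧ ∀ K, 0 < S.Wsh K) ∧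
      (∀ K : ℕ, θ K () 0 ≠ 1 + (1 / 2 : ℝ) ^ K / 8) ∧
      S_N21 SRec := by
  obtain ⟨F, ⟨Dat⟩⟩ := N21AtSpineCarriers.exists_family_and_datum
  have hρ0 : ∀ j, 0 ≤ (1 / 2 : ℝ) ^ j / 4 := fun j => by positivity
  have hr0 : ∀ j, 0 ≤ (1 / 2 : ℝ) ^ j / 8 := fun j => by positivity
  have hρ : Summable fun j => (1 / 2 : ℝ) ^ j / 4 :=
    (summable_geometric_of_lt_one (by norm_num) (by norm_num : (1 / 2 : ℝ) < 1)).div_const 4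
  have hr : Summable fun j => (1 / 2 : ℝ) ^ j / 8 :=
    (summable_geometric_of_lt_one (by norm_num) (by norm_num : (1 / 2 : ℝ) < 1)).div_const 8
  have hWsum : Summable fun K =>
      ∑ a ∈ range (0 + 1), (n a : ℝ) * lipWeight Lχ S (fun j => (1 / 2 : ℝ) ^ j / 4 + (1 / 2 : ℝ) ^ j / 8) a K := by
    rw [show (fun K => ∑ a ∈ range (0 + 1), (n a : ℝ) * lipWeight Lχ S (fun j => (1 / 2 : ℝ) ^ j / 4 + (1 / 2 : ℝ) ^ j / 8) a K) =
        fun K => 3 * (1 / 2 : ℝ) ^ K from funext bandWeight']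
    exact (summable_geometric_of_lt_one (by norm_num) (by norm_num : (1 / 2 : ℝ) < 1)).mul_left 3
  -- run B's realized shell part on the clamped pair is source-independent (`R ≡ 1`) and nonnegative (pv07's `shellW_nonneg` on `termRepr_syncB`)
  have hshB : ∀ (K : ℕ) (t : ℝ), 0 ≤ shellW χ μ m slot pol θ
      (fun K τ i _ => max ((1 - κ (slot K τ i).1) * θ K τ i) (min (θ K τ i)
            (θ K τ i / (1 + (1 / 2 : ℝ) ^ K / 8) * ((1 + (1 / 2 : ℝ) ^ K / 8) * (3 / 4 + (1 / 2 : ℝ) ^ K / 8)))))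
      (fun K τ i v => max ((1 - κ (slot K τ i).1) * θ K τ i) (min (θ K τ i) (uA K τ i v)))
      R K t () := by
    intro K t
    have e : shellW χ μ m slot pol θ
        (fun K τ i _ => max ((1 - κ (slot K τ i).1) * θ K τ i) (min (θ K τ i)
            (θ K τ i / (1 + (1 / 2 : ℝ) ^ K / 8) * ((1 + (1 / 2 : ℝ) ^ K / 8) * (3 / 4 + (1 / 2 : ℝ) ^ K / 8)))))
        (fun K τ i v => max ((1 - κ (slot K τ i).1) * θ K τ i) (min (θ K τ i) (uA K τ i v)))
        R K t () =
      shellW χ μ m slot pol θ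
        (fun K τ i _ => max ((1 - κ (slot K τ i).1) * θ K τ i) (min (θ K τ i)
            (θ K τ i / (1 + (1 / 2 : ℝ) ^ K / 8) * ((1 + (1 / 2 : ℝ) ^ K / 8) * (3 / 4 + (1 / 2 : ℝ) ^ K / 8)))))
        (fun K τ i v => max ((1 - κ (slot K τ i).1) * θ K τ i) (min (θ K τ i) (uA K τ i v)))
        R K 0 () := rfl
    rw [e]
    exact (termRepr_syncB termRepr_B' termRepr_A'.thr_pos).shellW_nonneg K 0 (by simp) () (by simp [T])
  refine ⟨_, fun _ _ _ _ _ h => h, ?_, ?_, s_N21_of_twoThresholdReprReading _ fun _ _ _ _ _ h => h⟩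
  · refine ⟨F, Dat, fun _ => 0, [],
      { ι := Unit, l₀ := 1, vol := 1, K₀ := 0, T := T, A := A, B := B,
        shA := shellW χ μ m slot pol θ
          (fun K τ i v => max ((1 - κ (slot K τ i).1) * θ K τ i) (min (θ K τ i) (uA K τ i v)))
          (fun K τ i _ => max ((1 - κ (slot K τ i).1) * θ K τ i) (min (θ K τ i)
            (θ K τ i / (1 + (1 / 2 : ℝ) ^ K / 8) * ((1 + (1 / 2 : ℝ) ^ K / 8) * (3 / 4 + (1 / 2 : ℝ) ^ K / 8)))))
          R,
        shB := shellW χ μ m slot pol θ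
          (fun K τ i _ => max ((1 - κ (slot K τ i).1) * θ K τ i) (min (θ K τ i)
            (θ K τ i / (1 + (1 / 2 : ℝ) ^ K / 8) * ((1 + (1 / 2 : ℝ) ^ K / 8) * (3 / 4 + (1 / 2 : ℝ) ^ K / 8)))))
          (fun K τ i v => max ((1 - κ (slot K τ i).1) * θ K τ i) (min (θ K τ i) (uA K τ i v)))
          R,
        Bad := fun _ _ => ∅, W := fun _ => 0,
        Wsh := fun K => ∑ a ∈ range (0 + 1), (n a : ℝ) * lipWeight Lχ S (fun j => (1 / 2 : ℝ) ^ j / 4 + (1 / 2 : ℝ) ^ j / 8) a K,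
        δ := fun _ => 0 }, ?_, ?_, ?_, ?_⟩
    · exact ⟨Ω, inferInstance, μ, χ, κ, Lχ, 0, n, m, slot, pol, θ, fun K _ _ => 1 + (1 / 2 : ℝ) ^ K / 8, uA,
        fun K _ _ _ => (1 + (1 / 2 : ℝ) ^ K / 8) * (3 / 4 + (1 / 2 : ℝ) ^ K / 8), R, R,
        fun j => (1 / 2 : ℝ) ^ j / 4, fun j => (1 / 2 : ℝ) ^ j / 8, S,
        termRepr_A', termRepr_B', supClose', fun K τ _ i _ => thresholdGap' K τ i,
        siblingSuppression_A' _ _, siblingSuppression_B' _ _, fun _ _ => by norm_num [S], hρ0, hr0, hρ, hr,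
        rfl, rfl, fun K => le_rfl, hWsum⟩
    · intro K; exact ⟨(), by simp [T]⟩
    · intro K t τ
      obtain ⟨⟩ := τ
      refine ⟨by norm_num [A], ?_, ?_, hshB K t⟩
      · have h1 := half_pow_le_one K
        simp only [B]
        linarith
      · show 0 < shellW χ μ m slot pol θ
          (fun K τ i v => max ((1 - κ (slot K τ i).1) * θ K τ i) (min (θ K τ i) (uA K τ i v)))
          (fun K τ i _ => max ((1 - κ (slot K τ i).1) * θ K τ i) (min (θ K τ i)
            (θ K τ i / (1 + (1 / 2 : ℝ) ^ K / 8) * ((1 + (1 / 2 : ℝ) ^ K / 8) * (3 / 4 + (1 / 2 : ℝ) ^ K / 8)))))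
          R K t ()
        rw [shellW_A' K t]
        exact div_pos (half_pow_pos K) (by norm_num)
    · intro K; show 0 < ∑ a ∈ range (0 + 1), (n a : ℝ) * lipWeight Lχ S (fun j => (1 / 2 : ℝ) ^ j / 4 + (1 / 2 : ℝ) ^ j / 8) a K
      rw [bandWeight' K]; exact mul_pos (by norm_num) (half_pow_pos K)
  · intro K
    simp only [θ, ne_eq]
    have := half_pow_pos K
    linarith

end NonVacuity

end Summit.QuantumFields.YangMills.Theorems.N21ProfiledThresholdSync

end
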